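import Mathlib
import HarnessLib
import Literature.Computability.AlgebraicComplexity.KroneckerRank
import Summits.MatrixMultiplication.MatrixMultiplication.Theorems.OutsiderSandwichBlockSubrank

/-!
# OutsiderSandwich — the block cut localises to ONE coupled block (decomp-mm lens-4, g17)

The three coupled blocks of `cw₂ ⊗ cw₂` are the leg rotations of one tensor, `C₃ = (C₁)_C`,
`C₂ = (C₁)_{C²}` (`OutsiderSandwichCouplingBenchmark.coupling₃_eq_rotate`,
`coupling₂_eq_rotate_rotate`), and the asymptotic spectrum is closed under leg rotation:
`F ↦ F_C`, `F_C(t) = F(t_C)`, maps universal spectral points to universal spectral points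
(`isUniversal_rotatePoint`) and fixes the value on `⟨2,2,2⟩` (`rotatePoint_matMul`, from the
cyclic symmetry `⟨k,m,n⟩_C ≅ ⟨m,n,k⟩`, tree `matMulTensor_rotate`).  Hence every piece of the g17
block cut is equivalent to its `k = 1` instance, a statement about the single `4 × 4 × 4` tensor
`C₁ = T^{[211]}` (eight ones; `(A; u, w) ↦ (Au, Aᵀw)`):

* `blockIsMM_iff_one : BlockIsMM ⟺ BlockOneIsMM` (`⟨2,2,2⟩ ≲ C₁`),
  `blockTangency_iff_one`, `blockMergeOptimal_iff_one`;
* the minimal-counterexample cut on ONE block, all hypothesis-free: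
  `summit_iff_blockOneIsMM : ω = 2 ⟺ BlockOneIsMM ∧ CouplingMergeOptimal`,
  `summit_iff_blockOne : ω = 2 ⟺ BlockOneTangency ∧ BlockOneMergeOptimal`,
  `blockOneIsMM_of_summit : ω = 2 ⟹ ⟨2,2,2⟩ ≲ C₁` (the ω-free leaf is necessary),
  `summit_of_blockOneIsMM : ⟨2,2,2⟩ ≲ C₁ ⟹ CouplingMergeOptimal ⟹ ω = 2`.
-/

noncomputable section

namespace Summit.MatrixMultiplication.MatrixMultiplication.Theorems.OutsiderSandwichBlockOne

open Literature.Computability.AlgebraicComplexity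
open Summit.MatrixMultiplication.MatrixMultiplication.Theorems.OutsiderSandwichCoupling
open Summit.MatrixMultiplication.MatrixMultiplication.Theorems.OutsiderSandwichTightSubrank

/-! ## 1. Rotation of spectral points -/

/-- The **rotated point** `F_C(t) = F(t_C)`. -/
def rotatePoint (F : SpectralMap ℂ) : SpectralMap ℂ := fun ⦃_ _ _⦄ t => F (rotate t)

/-- Unfolding `rotatePoint`. -/
theorem rotatePoint_apply (F : SpectralMap ℂ) {ι κ μ : Type} (t : ι → κ → μ → ℂ) :
    rotatePoint F t = F (rotate t) :=
  rfl

/-- `rotate (s ⊕ t) = rotate s ⊕ rotate t`. -/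
theorem rotate_directSum {ι κ μ ι' κ' μ' : Type} (s : ι → κ → μ → ℂ) (t : ι' → κ' → μ' → ℂ) :
    rotate (directSumTensor s t) = directSumTensor (rotate s) (rotate t) := by
  funext b c a
  rcases a with a | a <;> rcases b with b | b <;> rcases c with c | c <;> rfl

/-- `rotate (s ⊠ t) = rotate s ⊠ rotate t`. -/
theorem rotate_kronecker {ι κ μ ι' κ' μ' : Type} (s : ι → κ → μ → ℂ) (t : ι' → κ' → μ' → ℂ) :
    rotate (kroneckerTensor s t) = kroneckerTensor (rotate s) (rotate t) := by
  funext b c a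
  simp [rotate_apply, kroneckerTensor_apply]

/-- **The asymptotic spectrum is closed under leg rotation**: `F_C` is a universal spectral point
whenever `F` is. -/
theorem isUniversal_rotatePoint {F : SpectralMap ℂ} (hF : IsUniversalSpectralPoint ℂ F) :
    IsUniversalSpectralPoint ℂ (rotatePoint F) where
  nonneg t := hF.nonneg _
  map_directSum s t := by
    simp only [rotatePoint_apply]
    rw [rotate_directSum, hF.map_directSum]
  map_kronecker s t := by
    simp only [rotatePoint_apply]
    rw [rotate_kronecker, hF.map_kronecker]
  map_unitTensor_one := by
    simp only [rotatePoint_apply]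
    rw [rotate_unitTensor, hF.map_unitTensor_one]
  mono t s h := by
    simp only [rotatePoint_apply]
    exact hF.mono _ _ h.rotate

/-- `⟨k,m,n⟩_C` is `⟨m,n,k⟩` relabelled (cyclic symmetry of matrix multiplication). -/
theorem rotate_matMulTensor_eq (k m n : ℕ) :
    rotate (matMulTensor ℂ k m n) = fun b c a =>
      matMulTensor ℂ m n k (Equiv.prodComm (Fin k) (Fin m) b) c (Equiv.prodComm (Fin k) (Fin n) a) := by
  funext b c a
  simp only [rotate_apply, Equiv.prodComm_apply]
  exact matMulTensor_rotate ℂ k m n b c a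

/-- A universal spectral point takes the same value on `⟨k,m,n⟩_C` and `⟨m,n,k⟩`. -/
theorem map_rotate_matMulTensor {F : SpectralMap ℂ} (hF : IsUniversalSpectralPoint ℂ F)
    (k m n : ℕ) : F (rotate (matMulTensor ℂ k m n)) = F (matMulTensor ℂ m n k) := by
  rw [rotate_matMulTensor_eq]
  exact le_antisymm (hF.mono _ _ (tensorRestrictsTo_precomp _ _ _ _))
    (hF.mono _ _ (tensorRestrictsTo_of_reindex (matMulTensor ℂ m n k) (Equiv.prodComm _ _)
      (Equiv.refl _) (Equiv.prodComm _ _)))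

/-- In particular `F_C⟨2,2,2⟩ = F⟨2,2,2⟩`. -/
theorem rotatePoint_matMul {F : SpectralMap ℂ} (hF : IsUniversalSpectralPoint ℂ F) :
    rotatePoint F (matMulTensor ℂ 2 2 2) = F (matMulTensor ℂ 2 2 2) :=
  map_rotate_matMulTensor hF 2 2 2

/-- `F(C₃) = F_C(C₁)`. -/
theorem map_coupling₃ (F : SpectralMap ℂ) : F coupling₃ = rotatePoint F coupling₁ := by
  rw [OutsiderSandwichCouplingBenchmark.coupling₃_eq_rotate]; rfl

/-- `F(C₂) = F_{C²}(C₁)`. -/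
theorem map_coupling₂ (F : SpectralMap ℂ) :
    F coupling₂ = rotatePoint (rotatePoint F) coupling₁ := by
  rw [OutsiderSandwichCouplingBenchmark.coupling₂_eq_rotate_rotate]; rfl

/-! ## 2. The one-block pieces -/

/-- **BlockOneIsMM** (ω-free leaf on one block): `⟨2,2,2⟩ ≲ C₁`, i.e. `F⟨2,2,2⟩ ≤ F(C₁)` at every
universal spectral point. -/
def BlockOneIsMM : Prop :=
  ∀ F : SpectralMap ℂ, IsUniversalSpectralPoint ℂ F → F (matMulTensor ℂ 2 2 2) ≤ F coupling₁

/-- **BlockOneTangency**: every universal spectral point with matrix exponent `τ_F > 2` is strictly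
super-MM on `C₁`. -/
def BlockOneTangency : Prop :=
  ∀ F : SpectralMap ℂ, IsUniversalSpectralPoint ℂ F → 2 < Real.logb 2 (F (matMulTensor ℂ 2 2 2)) →
    F (matMulTensor ℂ 2 2 2) < F coupling₁

/-- **BlockOneMergeOptimal**: some ω-attaining universal spectral point is not strictly super-MM
on `C₁`. -/
def BlockOneMergeOptimal : Prop :=
  ∃ F : SpectralMap ℂ, IsUniversalSpectralPoint ℂ F ∧
    Real.logb 2 (F (matMulTensor ℂ 2 2 2)) = omega ℂ ∧ F coupling₁ ≤ F (matMulTensor ℂ 2 2 2)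

/-- `BlockIsMM ⟺ BlockOneIsMM`. -/
theorem blockIsMM_iff_one : OutsiderSandwichBlock.BlockIsMM ↔ BlockOneIsMM := by
  refine ⟨fun h F hF => (h F hF).1, fun h F hF => ⟨h F hF, ?_, ?_⟩⟩
  · have h2 := h _ (isUniversal_rotatePoint (isUniversal_rotatePoint hF))
    rw [rotatePoint_matMul (isUniversal_rotatePoint hF), rotatePoint_matMul hF] at h2
    rw [map_coupling₂ F]
    exact h2
  · have h3 := h _ (isUniversal_rotatePoint hF)
    rw [rotatePoint_matMul hF] at h3
    rw [map_coupling₃ F]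
    exact h3

/-- `BlockTangency ⟺ BlockOneTangency`. -/
theorem blockTangency_iff_one : OutsiderSandwichBlock.BlockTangency ↔ BlockOneTangency := by
  refine ⟨fun h F hF hτ => (h F hF hτ).1, fun h F hF hτ => ⟨h F hF hτ, ?_, ?_⟩⟩
  · have hF2 := isUniversal_rotatePoint (isUniversal_rotatePoint hF)
    have e2 : rotatePoint (rotatePoint F) (matMulTensor ℂ 2 2 2) = F (matMulTensor ℂ 2 2 2) := by
      rw [rotatePoint_matMul (isUniversal_rotatePoint hF), rotatePoint_matMul hF]
    have h2 := h _ hF2 (by rw [e2]; exact hτ)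
    rw [e2] at h2
    rw [map_coupling₂ F]
    exact h2
  · have hF3 := isUniversal_rotatePoint hF
    have h3 := h _ hF3 (by rw [rotatePoint_matMul hF]; exact hτ)
    rw [rotatePoint_matMul hF] at h3
    rw [map_coupling₃ F]
    exact h3

/-- `BlockMergeOptimal ⟺ BlockOneMergeOptimal`. -/
theorem blockMergeOptimal_iff_one : OutsiderSandwichBlock.BlockMergeOptimal ↔ BlockOneMergeOptimal := by
  refine ⟨?_, fun ⟨F, hF, hτ, hle⟩ => ⟨F, hF, hτ, Or.inl hle⟩⟩
  rintro ⟨F, hF, hτ, h1 | h2 | h3⟩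
  · exact ⟨F, hF, hτ, h1⟩
  · have e2 : rotatePoint (rotatePoint F) (matMulTensor ℂ 2 2 2) = F (matMulTensor ℂ 2 2 2) := by
      rw [rotatePoint_matMul (isUniversal_rotatePoint hF), rotatePoint_matMul hF]
    refine ⟨_, isUniversal_rotatePoint (isUniversal_rotatePoint hF), by rw [e2]; exact hτ, ?_⟩
    rw [e2, ← map_coupling₂ F]
    exact h2
  · refine ⟨_, isUniversal_rotatePoint hF, by rw [rotatePoint_matMul hF]; exact hτ, ?_⟩
    rw [rotatePoint_matMul hF, ← map_coupling₃ F]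
    exact h3

/-! ## 3. The minimal-counterexample cut on one block (all hypothesis-free) -/

/-- **`ω = 2 ⟺ ⟨2,2,2⟩ ≲ C₁ ∧ CouplingMergeOptimal`.** -/
theorem summit_iff_blockOneIsMM :
    _root_.MatrixMultiplication ↔ BlockOneIsMM ∧ CouplingMergeOptimal := by
  rw [← blockIsMM_iff_one]
  exact OutsiderSandwichBlockSubrank.summit_iff_blockIsMM

/-- **`ω = 2 ⟺ BlockOneTangency ∧ BlockOneMergeOptimal`.** -/
theorem summit_iff_blockOne :
    _root_.MatrixMultiplication ↔ BlockOneTangency ∧ BlockOneMergeOptimal := by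
  rw [← blockTangency_iff_one, ← blockMergeOptimal_iff_one]
  exact OutsiderSandwichBlock.summit_iff_block

/-- **The leaf is necessary**: `ω = 2 ⟹ ⟨2,2,2⟩ ≲ C₁`. -/
theorem blockOneIsMM_of_summit (hS : _root_.MatrixMultiplication) : BlockOneIsMM :=
  (summit_iff_blockOneIsMM.1 hS).1

/-- `ω = 2 ⟹ BlockOneTangency`. -/
theorem blockOneTangency_of_summit (hS : _root_.MatrixMultiplication) : BlockOneTangency :=
  (summit_iff_blockOne.1 hS).1

/-- `ω = 2 ⟹ BlockOneMergeOptimal`. -/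
theorem blockOneMergeOptimal_of_summit (hS : _root_.MatrixMultiplication) : BlockOneMergeOptimal :=
  (summit_iff_blockOne.1 hS).2

/-- **`⟨2,2,2⟩ ≲ C₁ ⟹ CouplingMergeOptimal ⟹ ω = 2`.** -/
theorem summit_of_blockOneIsMM (h : BlockOneIsMM) (hR : CouplingMergeOptimal) :
    _root_.MatrixMultiplication :=
  summit_iff_blockOneIsMM.2 ⟨h, hR⟩

/-- `BlockOneTangency ⟹ BlockOneMergeOptimal ⟹ ω = 2`. -/
theorem summit_of_blockOne (hA : BlockOneTangency) (hR : BlockOneMergeOptimal) :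
    _root_.MatrixMultiplication :=
  summit_iff_blockOne.2 ⟨hA, hR⟩

/-- Under the residual, leaf and strict piece coincide on one block:
`CouplingMergeOptimal ⟹ (BlockOneIsMM ⟺ BlockOneTangency)`. -/
theorem blockOneIsMM_iff_blockOneTangency (hR : CouplingMergeOptimal) :
    BlockOneIsMM ↔ BlockOneTangency :=
  ⟨fun h => blockOneTangency_of_summit (summit_of_blockOneIsMM h hR),
    fun h => blockOneIsMM_of_summit (summit_of_blockOne h
      (blockMergeOptimal_iff_one.1 (OutsiderSandwichBlock.blockMergeOptimal_of_couplingMergeOptimal hR)))⟩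

/-- `4 ≤ F(C₁) = F_C…`: the three block values of a universal point are the values of the three
rotated points on `C₁`, and `F(C) = F(C₁) · F_{C²}(C₁) · F_C(C₁)`. -/
theorem map_blocks_eq (F : SpectralMap ℂ) :
    F coupling₁ * F coupling₂ * F coupling₃ =
      F coupling₁ * rotatePoint (rotatePoint F) coupling₁ * rotatePoint F coupling₁ := by
  rw [map_coupling₂ F, map_coupling₃ F]

end Summit.MatrixMultiplication.MatrixMultiplication.Theorems.OutsiderSandwichBlockOne
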